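import Summits.QuantumFields.QCD.Theses.HeatSlicedQuarks
import Summits.QuantumFields.QCD.Theorems.HeatSlicedQuarksQuarkLoopCoefficientDefs

/-!
# Quark-loop coefficient, stub `freeMajorantToolkit`, part A: profile algebra and lattice sums

Elementary real analysis behind the profile calculus of the two-regime Gaussian majorant
`Γ_c(t, w) = (1+t)⁻² exp(−c|w|²/(1 + t + |w|))` (`gaussProfile`) of the line `Sketch` of the crux
`QuarkLoopCoefficient`:

* the exponent `f_K(r) = r²/(K + r)`: monotone in `r`, `1`-Lipschitz in `r`, antitone in `K` with
  unit cost for a unit increase of `K`, dominates the linear function `r/(2√K) − 1/2`, and Engel's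
  form of the Cauchy–Schwarz inequality with the defect made explicit;
* lattice sums: the two-sided geometric series on `ℤ` and the product majorant principle on `ℤ⁴`
  (`Site 4 = Fin 4 → ℤ`): a nonnegative function dominated by a product of summable one-dimensional
  profiles is summable with the product bound;
* the Euclidean length `elen`: nonnegativity, coordinate bounds, evenness, the triangle inequality,
  scaling, and `1 ≤ |n|` for `n ≠ 0`;
* positivity and monotonicity in `c` of `gaussProfile`.

Mathlib only.
-/

namespace Summit.QuantumFields.QCD.Cruxes.QuarkLoopCoefficient.Sketch.FreeMajorantToolkit

open Summit.QuantumFields.QCD.Theorems.QuarkLoopCoefficient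
open Literature.MathematicalPhysics.QuantumLattice Literature.MathematicalPhysics.QuantumFieldTheory
open Literature.Probability.LatticeModels (Site TorusSite)
open scoped Matrix ComplexConjugate

/-! ### The profile exponent `f_K(r) = r² / (K + r)` -/

/-- Monotonicity of the profile exponent in `r`: `r²/(K+r) ≤ s²/(K+s)` for `0 ≤ r ≤ s`, `K > 0`. -/
theorem sq_div_add_mono {K r s : ℝ} (hK : 0 < K) (hr : 0 ≤ r) (hrs : r ≤ s) :
    r ^ 2 / (K + r) ≤ s ^ 2 / (K + s) := by
  rw [div_le_div_iff₀ (by linarith) (by linarith)]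
  have hs : 0 ≤ s := hr.trans hrs
  nlinarith [mul_nonneg (sub_nonneg.2 hrs) (by positivity : (0 : ℝ) ≤ K * (s + r) + r * s)]

/-- The profile exponent is `1`-Lipschitz in `r`: `r²/(K+r) − s²/(K+s) ≤ |r − s|` (`K > 0`). -/
theorem sq_div_add_sub_le {K r s : ℝ} (hK : 0 < K) (hr : 0 ≤ r) (hs : 0 ≤ s) :
    r ^ 2 / (K + r) - s ^ 2 / (K + s) ≤ |r - s| := by
  have h1 : 0 < K + r := by linarith
  have h2 : 0 < K + s := by linarith
  have key : r ^ 2 / (K + r) - s ^ 2 / (K + s) =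
      (r - s) * (1 - K ^ 2 / ((K + r) * (K + s))) := by
    field_simp
    ring
  rw [key]
  have hθ0 : 0 ≤ 1 - K ^ 2 / ((K + r) * (K + s)) := by
    rw [sub_nonneg, div_le_one₀ (by positivity)]
    nlinarith [mul_nonneg hr hs, mul_nonneg hK.le hr, mul_nonneg hK.le hs]
  have hθ1 : 1 - K ^ 2 / ((K + r) * (K + s)) ≤ 1 := by
    have : 0 ≤ K ^ 2 / ((K + r) * (K + s)) := by positivity
    linarith
  calc (r - s) * (1 - K ^ 2 / ((K + r) * (K + s)))
      ≤ |r - s| * (1 - K ^ 2 / ((K + r) * (K + s))) :=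
        mul_le_mul_of_nonneg_right (le_abs_self _) hθ0
    _ ≤ |r - s| * 1 := mul_le_mul_of_nonneg_left hθ1 (abs_nonneg _)
    _ = |r - s| := mul_one _

/-- The profile exponent decreases in `K`: `r²/(K'+r) ≤ r²/(K+r)` for `0 < K ≤ K'`. -/
theorem sq_div_add_anti {K K' r : ℝ} (hK : 0 < K) (hKK' : K ≤ K') (hr : 0 ≤ r) :
    r ^ 2 / (K' + r) ≤ r ^ 2 / (K + r) :=
  div_le_div_of_nonneg_left (sq_nonneg r) (by linarith) (by linarith)

/-- Raising `K` by at most `1` costs at most `1`: `r²/(K+r) ≤ r²/(K'+r) + 1` for `K ≤ K' ≤ K + 1`. -/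
theorem sq_div_add_le_add_one {K K' r : ℝ} (hK : 0 < K) (hKK' : K ≤ K') (hK'K : K' ≤ K + 1)
    (hr : 0 ≤ r) : r ^ 2 / (K + r) ≤ r ^ 2 / (K' + r) + 1 := by
  have h1 : 0 < K + r := by linarith
  have h2 : 0 < K' + r := by linarith
  rw [div_add_one h2.ne', div_le_div_iff₀ h1 h2]
  nlinarith [mul_nonneg hr (sub_nonneg.2 hKK'), mul_nonneg hK.le hr, sq_nonneg r,
    mul_nonneg (sub_nonneg.2 hK'K) hr]

/-- The linear lower bound `r/(2√K) − 1/2 ≤ r²/(K+r)` (`K ≥ 1`, `r ≥ 0`): the profile exponent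
dominates a linear function of slope `1/(2√K)` up to an absolute constant. -/
theorem linear_le_sq_div_add {K r : ℝ} (hK : 1 ≤ K) (hr : 0 ≤ r) :
    r / (2 * Real.sqrt K) - 1 / 2 ≤ r ^ 2 / (K + r) := by
  set s := Real.sqrt K with hs
  have hs1 : 1 ≤ s := Real.one_le_sqrt.mpr hK
  have hK' : K = s ^ 2 := by rw [hs, Real.sq_sqrt (by linarith)]
  have hs0 : 0 < s := by linarith
  rw [hK']
  have hden : 0 < s ^ 2 + r := by positivity
  have key : r ^ 2 / (s ^ 2 + r) - (r / (2 * s) - 1 / 2) =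
      ((2 * s - 1) * r ^ 2 - s ^ 2 * r + s * r + s ^ 3) / (2 * s * (s ^ 2 + r)) := by
    field_simp
    ring
  rw [← sub_nonneg, key]
  apply div_nonneg _ (by positivity)
  nlinarith [mul_nonneg hs0.le (sq_nonneg (r - s)), mul_nonneg (sub_nonneg.2 hs1) (sq_nonneg r),
    mul_nonneg (mul_nonneg hs0.le (by linarith : (0:ℝ) ≤ s + 1)) hr]

/-- Engel's form of the Cauchy–Schwarz inequality with the defect made explicit:
`x²/p + z²/q = (x+z)²/(p+q) + (xq − zp)²/(pq(p+q))` (`p, q > 0`). -/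
theorem sq_div_add_sq_div_eq {x z p q : ℝ} (hp : 0 < p) (hq : 0 < q) :
    x ^ 2 / p + z ^ 2 / q = (x + z) ^ 2 / (p + q) + (x * q - z * p) ^ 2 / (p * q * (p + q)) := by
  field_simp
  ring

/-- Weighted Engel inequality: `(x+z)²/(p/α + q/β) ≤ α x²/p + β z²/q` (`p, q, α, β > 0`). -/
theorem sq_add_div_le_weighted {x z p q α β : ℝ} (hp : 0 < p) (hq : 0 < q) (hα : 0 < α)
    (hβ : 0 < β) : (x + z) ^ 2 / (p / α + q / β) ≤ α * x ^ 2 / p + β * z ^ 2 / q := by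
  have h := sq_div_add_sq_div_eq (x := x) (z := z) (div_pos hp hα) (div_pos hq hβ)
  have e1 : x ^ 2 / (p / α) = α * x ^ 2 / p := by field_simp
  have e2 : z ^ 2 / (q / β) = β * z ^ 2 / q := by field_simp
  rw [e1, e2] at h
  rw [h]
  have : 0 ≤ (x * (q / β) - z * (p / α)) ^ 2 / (p / α * (q / β) * (p / α + q / β)) := by positivity
  linarith

/-! ### Lattice sums: the two-sided geometric series and product majorants on `ℤ⁴` -/

/-- The two-sided geometric series `Σ_{k ∈ ℤ} e^{−β|k|} ≤ 2 + 2/β` (`β > 0`), with summability. -/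
theorem summable_exp_neg_mul_abs_int {β : ℝ} (hβ : 0 < β) :
    Summable (fun k : ℤ => Real.exp (-(β * |(k : ℝ)|))) ∧
      ∑' k : ℤ, Real.exp (-(β * |(k : ℝ)|)) ≤ 2 + 2 / β := by
  set r := Real.exp (-β) with hr
  have hr0 : 0 ≤ r := (Real.exp_pos _).le
  have hr1 : r < 1 := Real.exp_lt_one_iff.mpr (by linarith)
  have hnat : ∀ n : ℕ, Real.exp (-(β * |((n : ℤ) : ℝ)|)) = r ^ n := by
    intro n
    rw [hr, ← Real.exp_nat_mul, Int.cast_natCast, Nat.abs_cast]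
    ring_nf
  have hneg : ∀ n : ℕ, Real.exp (-(β * |((-(n + 1 : ℤ)) : ℝ)|)) = r * r ^ n := by
    intro n
    rw [hr, ← pow_succ', ← Real.exp_nat_mul]
    congr 1
    have h0 : ((-(n + 1 : ℤ) : ℝ)) = -((n : ℝ) + 1) := by push_cast; ring
    rw [h0, abs_neg, abs_of_nonneg (by positivity)]
    push_cast
    ring
  have hneg' : ∀ n : ℕ, Real.exp (-(β * |(((-(n : ℤ) : ℤ)) : ℝ)|)) = r ^ n := by
    intro n
    rw [← hnat n]
    push_cast
    rw [abs_neg]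
  have hs1 : Summable fun n : ℕ => Real.exp (-(β * |((n : ℤ) : ℝ)|)) := by
    simp_rw [hnat]; exact summable_geometric_of_lt_one hr0 hr1
  have hs2 : Summable fun n : ℕ => Real.exp (-(β * |(((-(n : ℤ) : ℤ)) : ℝ)|)) := by
    simp_rw [hneg']; exact summable_geometric_of_lt_one hr0 hr1
  have hs3 : Summable fun n : ℕ => Real.exp (-(β * |((-(n + 1 : ℤ)) : ℝ)|)) := by
    simp_rw [hneg]; exact (summable_geometric_of_lt_one hr0 hr1).mul_left r
  refine ⟨Summable.of_nat_of_neg hs1 hs2, ?_⟩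
  have hsum := tsum_of_nat_of_neg_add_one
    (f := fun k : ℤ => Real.exp (-(β * |(k : ℝ)|))) hs1 ?_
  · rw [hsum]
    simp_rw [hnat]
    have h2 : ∑' n : ℕ, Real.exp (-(β * |(((-((n : ℤ) + 1) : ℤ)) : ℝ)|)) = r * (1 - r)⁻¹ := by
      have : ∀ n : ℕ, Real.exp (-(β * |(((-((n : ℤ) + 1) : ℤ)) : ℝ)|)) = r * r ^ n := fun n => by
        exact_mod_cast hneg n
      simp_rw [this]
      rw [tsum_mul_left, tsum_geometric_of_lt_one hr0 hr1]
    rw [tsum_geometric_of_lt_one hr0 hr1, h2]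
    have h1r : β / (1 + β) ≤ 1 - r := by
      have hexp : β + 1 ≤ Real.exp β := Real.add_one_le_exp β
      have : r * Real.exp β = 1 := by rw [hr, ← Real.exp_add]; simp
      rw [div_le_iff₀ (by linarith)]
      nlinarith [mul_le_mul_of_nonneg_left hexp hr0]
    have h1r' : 0 < 1 - r := by linarith
    have : (1 - r)⁻¹ ≤ (1 + β) / β := by
      rw [inv_eq_one_div, div_le_div_iff₀ h1r' hβ]
      rw [div_le_iff₀ (by linarith)] at h1r
      linarith
    calc (1 - r)⁻¹ + r * (1 - r)⁻¹ ≤ (1 - r)⁻¹ + 1 * (1 - r)⁻¹ := by gcongr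
      _ = 2 * (1 - r)⁻¹ := by ring
      _ ≤ 2 * ((1 + β) / β) := by gcongr
      _ = 2 + 2 / β := by field_simp; ring
  · exact_mod_cast hs3

/-- Product majorants on `ℤ⁴`: if `0 ≤ F(y) ≤ C Π_μ g(y_μ)` with `g ≥ 0` summable on `ℤ`, then `F` is
summable on `ℤ⁴` and `Σ_y F(y) ≤ C (Σ_k g(k))⁴` (finite partial sums factor over a box). -/
theorem summable_site_of_le_prod {F : Site 4 → ℝ} {g : ℤ → ℝ} {C : ℝ} (hF : ∀ y, 0 ≤ F y)
    (hg : ∀ k, 0 ≤ g k) (hgs : Summable g) (hC : 0 ≤ C)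
    (hle : ∀ y, F y ≤ C * ∏ μ, g (y μ)) :
    Summable F ∧ ∑' y, F y ≤ C * (∑' k, g k) ^ 4 := by
  classical
  have bound : ∀ u : Finset (Site 4), ∑ y ∈ u, F y ≤ C * (∑' k, g k) ^ 4 := by
    intro u
    set box : Finset (Site 4) := Fintype.piFinset (fun μ => u.image (fun y => y μ)) with hbox
    have hsub : u ⊆ box := fun y hy =>
      Fintype.mem_piFinset.2 (fun μ => Finset.mem_image_of_mem _ hy)
    calc ∑ y ∈ u, F y ≤ ∑ y ∈ box, F y :=
          Finset.sum_le_sum_of_subset_of_nonneg hsub (fun y _ _ => hF y)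
      _ ≤ ∑ y ∈ box, C * ∏ μ, g (y μ) := Finset.sum_le_sum (fun y _ => hle y)
      _ = C * ∏ μ : Fin 4, ∑ k ∈ u.image (fun y => y μ), g k := by
          rw [← Finset.mul_sum, Finset.prod_univ_sum]
      _ ≤ C * ∏ _μ : Fin 4, ∑' k, g k := by
          gcongr with μ
          · exact fun μ _ => Finset.sum_nonneg (fun k _ => hg k)
          · exact hgs.sum_le_tsum _ (fun k _ => hg k)
      _ = C * (∑' k, g k) ^ 4 := by
          rw [Finset.prod_const, Finset.card_univ, Fintype.card_fin]
  exact ⟨summable_of_sum_le hF bound, Real.tsum_le_of_sum_le hF bound⟩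

/-- The two-sided geometric majorant on `ℤ⁴`: if `0 ≤ F(y) ≤ C e^{−β Σ_μ |y_μ|}` (`β > 0`, `C ≥ 0`), then
`F` is summable and `Σ_y F(y) ≤ C (2 + 2/β)⁴`. -/
theorem summable_site_of_le_exp_sum_abs {F : Site 4 → ℝ} {β C : ℝ} (hβ : 0 < β) (hC : 0 ≤ C)
    (hF : ∀ y, 0 ≤ F y)
    (hle : ∀ y, F y ≤ C * Real.exp (-(β * ∑ μ : Fin 4, |((y μ : ℤ) : ℝ)|))) :
    Summable F ∧ ∑' y, F y ≤ C * (2 + 2 / β) ^ 4 := by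
  obtain ⟨hgs, hgle⟩ := summable_exp_neg_mul_abs_int hβ
  have hle' : ∀ y : Site 4, F y ≤ C * ∏ μ, Real.exp (-(β * |((y μ : ℤ) : ℝ)|)) := by
    intro y
    rw [← Real.exp_sum]
    convert hle y using 3
    rw [Finset.mul_sum, Finset.sum_neg_distrib]
  obtain ⟨hs, hsum⟩ := summable_site_of_le_prod hF (fun k => (Real.exp_pos _).le) hgs hC hle'
  refine ⟨hs, hsum.trans ?_⟩
  gcongr

/-! ### The Euclidean length `elen` -/

/-- `0 ≤ |w|`. -/
theorem elen_nonneg (w : Site 4) : 0 ≤ elen w := Real.sqrt_nonneg _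

/-- `|w|² = Σ_μ w_μ²`. -/
theorem elen_sq (w : Site 4) : elen w ^ 2 = ∑ μ : Fin 4, ((w μ : ℤ) : ℝ) ^ 2 :=
  Real.sq_sqrt (Finset.sum_nonneg fun _ _ => sq_nonneg _)

/-- Each coordinate is bounded by the length: `|w_μ| ≤ |w|`. -/
theorem abs_apply_le_elen (w : Site 4) (μ : Fin 4) : |((w μ : ℤ) : ℝ)| ≤ elen w := by
  rw [← Real.sqrt_sq_eq_abs]
  exact Real.sqrt_le_sqrt (Finset.single_le_sum (f := fun ν : Fin 4 => ((w ν : ℤ) : ℝ) ^ 2)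
    (fun ν _ => sq_nonneg _) (Finset.mem_univ μ))

/-- The `ℓ¹` length is at most four times the Euclidean length. -/
theorem sum_abs_le_four_mul_elen (w : Site 4) : ∑ μ : Fin 4, |((w μ : ℤ) : ℝ)| ≤ 4 * elen w := by
  calc ∑ μ : Fin 4, |((w μ : ℤ) : ℝ)| ≤ ∑ _μ : Fin 4, elen w :=
        Finset.sum_le_sum fun μ _ => abs_apply_le_elen w μ
    _ = 4 * elen w := by simp

/-- Evenness: `|−w| = |w|`. -/
theorem elen_neg (w : Site 4) : elen (-w) = elen w := by
  unfold elen
  congr 1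
  exact Finset.sum_congr rfl fun μ _ => by simp

/-- Symmetry of the distance: `|w − y| = |y − w|`. -/
theorem elen_sub_comm (w y : Site 4) : elen (w - y) = elen (y - w) := by
  rw [← elen_neg, neg_sub]

/-- `|0| = 0`. -/
theorem elen_zero : elen (0 : Site 4) = 0 := by simp [elen]

/-- The triangle inequality for the Euclidean length. -/
theorem elen_add_le (w z : Site 4) : elen (w + z) ≤ elen w + elen z := by
  have hw := elen_nonneg w
  have hz := elen_nonneg z
  have hcs : ∑ μ : Fin 4, ((w μ : ℤ) : ℝ) * ((z μ : ℤ) : ℝ) ≤ elen w * elen z := by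
    have h := Finset.sum_mul_sq_le_sq_mul_sq Finset.univ (fun μ : Fin 4 => ((w μ : ℤ) : ℝ))
      (fun μ : Fin 4 => ((z μ : ℤ) : ℝ))
    have h2 : |∑ μ : Fin 4, ((w μ : ℤ) : ℝ) * ((z μ : ℤ) : ℝ)| ≤ elen w * elen z := by
      rw [elen, elen, ← Real.sqrt_mul (Finset.sum_nonneg fun μ _ => sq_nonneg _)]
      exact Real.abs_le_sqrt h
    exact (le_abs_self _).trans h2
  unfold elen
  rw [Real.sqrt_le_left (by positivity)]
  have e : ∑ μ : Fin 4, (((w + z) μ : ℤ) : ℝ) ^ 2 = ∑ μ : Fin 4, ((w μ : ℤ) : ℝ) ^ 2 +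
      2 * ∑ μ : Fin 4, ((w μ : ℤ) : ℝ) * ((z μ : ℤ) : ℝ) + ∑ μ : Fin 4, ((z μ : ℤ) : ℝ) ^ 2 := by
    simp only [Pi.add_apply, Int.cast_add, Finset.mul_sum, ← Finset.sum_add_distrib]
    exact Finset.sum_congr rfl fun μ _ => by ring
  rw [e, add_sq, ← elen, ← elen, elen_sq, elen_sq]
  linarith

/-- Lengths of nearby points: `|w| ≤ |w + z| + |z|`. -/
theorem elen_le_elen_add_add (w z : Site 4) : elen w ≤ elen (w + z) + elen z := by
  have h := elen_add_le (w + z) (-z)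
  rwa [add_neg_cancel_right, elen_neg] at h

/-- A nonzero lattice vector has length at least `1`. -/
theorem one_le_elen {n : Site 4} (hn : n ≠ 0) : 1 ≤ elen n := by
  obtain ⟨μ, hμ⟩ := Function.ne_iff.1 hn
  have h1 : (1 : ℝ) ≤ ((n μ : ℤ) : ℝ) ^ 2 := by
    have : (1 : ℤ) ≤ (n μ) ^ 2 := by
      have := Int.one_le_abs hμ
      nlinarith [sq_abs (n μ)]
    exact_mod_cast this
  unfold elen
  rw [Real.one_le_sqrt]
  exact h1.trans (Finset.single_le_sum (f := fun ν : Fin 4 => ((n ν : ℤ) : ℝ) ^ 2)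
    (fun ν _ => sq_nonneg _) (Finset.mem_univ μ))

/-- Scaling: `|L • n| = L |n|` for a natural number `L`. -/
theorem elen_natMul (L : ℕ) (n : Site 4) :
    elen (fun μ => (L : ℤ) * n μ) = (L : ℝ) * elen n := by
  unfold elen
  have e : ∑ μ : Fin 4, ((((L : ℤ) * n μ : ℤ)) : ℝ) ^ 2 =
      (L : ℝ) ^ 2 * ∑ μ : Fin 4, ((n μ : ℤ) : ℝ) ^ 2 := by
    rw [Finset.mul_sum]
    exact Finset.sum_congr rfl fun μ _ => by push_cast; ring
  rw [e, Real.sqrt_mul (sq_nonneg _), Real.sqrt_sq (Nat.cast_nonneg L)]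

/-! ### The profile `gaussProfile` -/

/-- The profile is nonnegative. -/
theorem gaussProfile_nonneg (c t : ℝ) (w : Site 4) : 0 ≤ gaussProfile c t w := by
  unfold gaussProfile; positivity

/-- The profile decreases in the constant `c` (for `t ≥ 0`). -/
theorem gaussProfile_anti {c c' t : ℝ} (hcc' : c' ≤ c) (ht : 0 ≤ t) (w : Site 4) :
    gaussProfile c t w ≤ gaussProfile c' t w := by
  unfold gaussProfile
  have hr := elen_nonneg w
  gcongr

/-- Registered headline of this helper file (aux stub of `stub_freeMajorantToolkit`): the product
majorant principle on `ℤ⁴`. -/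
theorem stub_freeMajorantToolkitAux : ∀ (F : Site 4 → ℝ) (g : ℤ → ℝ) (C : ℝ), (∀ y, 0 ≤ F y) → (∀ k, 0 ≤ g k) → Summable g → 0 ≤ C → (∀ y, F y ≤ C * ∏ μ, g (y μ)) → Summable F ∧ ∑' y, F y ≤ C * (∑' k, g k) ^ 4 :=
  fun _ _ _ hF hg hgs hC hle => summable_site_of_le_prod hF hg hgs hC hle

end Summit.QuantumFields.QCD.Cruxes.QuarkLoopCoefficient.Sketch.FreeMajorantToolkit
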